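import Summits.ResolutionOfSingularities.ResolutionOfSingularities.Theorems.PurelyInseparableDim4ExceptionalLengthFree
import Summits.ResolutionOfSingularities.ResolutionOfSingularities.Theorems.PurelyInseparableDim4JetColength
import HarnessLib
import HarnessLib.Audit.Tags

/-!
# Purely inseparable dim 4 — (Λ2): the new exceptional length is at most `μ⁺ − 1`

Sequel of `PurelyInseparableDim4ExceptionalLength` (p662098), `PurelyInseparableDim4ExceptionalLengthFree` ((Λ1),
p662834) and `PurelyInseparableDim4JetColength` (p661642/p661862).  CARD I-3-12 of cell `res-dim4-pi` (seat
idea-3), law (Λ2) in typed form ((Λ1) `forall_X_pow_pred_mem_of_free` is the previous file):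

* **(Λ2)** `forall_X_pow_jetColength_pred_mem`: if `F` carries a colength certificate `IsCert p N F` with
  `μ⁺ = jetColength p N F ≥ 1`, then after ANY move in chart `j` (any `b` with `b_j = 0`) the new exceptional
  coordinate satisfies `x_j^{μ⁺−1} ∈ J_p⁺(F') + 𝔪₀^M` for every `M` — the exceptional length of the successor
  is at most `μ⁺(F) − 1` (whence the free-run bound (Λ3) of the card: at most `μ⁺ − 2` consecutive E-free moves).

[cite: Kollar2007, (3.75.1)–(3.75.3) and Theorem 3.76 (derivative ideals under blow-up; char p, m = p)]
OURS · counted 0 · nothing here proves `NoWideTrap`, `NoIsolatedTrap 3 3`, or resolution of singularities in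
dimension `≥ 4` / characteristic `p`.  bears_on: LADDER-RESOLUTION:D157-DOOR2 (res-dim4-pi · I-3-12 (Λ2)).

Typed by seat res-dim4-idea-3 (CARD I-3-12 ADD. 3, `HOME/res-dim4-idea-3/lean/ExcLengthBound.lean`, sha16
`344be4576602d53d`); landed by seat res-dim4-p-5 g2 under DR-157-C verbatim, except: this paragraph, the import of
`…ExceptionalLengthFree`, and the removal of the primed standalone copies of (Λ1) (the tree names are called).
Supports stmt-ResolutionOfSingularities-16155 (helper).
-/

set_option linter.dupNamespace false -- mandated namespace of this single-conjunct summit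

namespace Summit.ResolutionOfSingularities.ResolutionOfSingularities.Theorems.PIDim4

namespace ExceptionalLength

open MvPolynomial Finset
open Literature.AlgebraicGeometry
open Literature.AlgebraicGeometry.Resolution

variable {K : Type} [Field K]

/-- **(Λ2) The successor's exceptional length is at most `μ⁺ − 1`** (CARD I-3-12 (Λ2)): if `F` (order `≥ p`)
carries a colength certificate `IsCert p N F` and `μ⁺ := jetColength p N F ≥ 1`, then after the move in chart
`j` at ANY point `b` of the exceptional hyperplane (`b_j = 0`), `x_j^{μ⁺−1} ∈ J_p⁺(F') + 𝔪₀^M` for every `M`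
(`x_j^{μ⁺} ∈ J_p⁺(F) + 𝔪₀^M` by `RidgeBudget.X_pow_jetColength_mem`, then law (U)).
[cite: Kollar2007, Theorem 3.76 (char p, m = p)] -/
theorem forall_X_pow_jetColength_pred_mem (p : ℕ) [Fact p.Prime] [CharP K p] [DecidableEq K]
    (s : State K) (j : Fin 4) (b : Fin 4 → K) (hbj : b j = 0)
    (hord : (p : ℕ∞) ≤ CentreBlowup.ordAlong Finset.univ s.F) {N : ℕ}
    (hc : RidgeBudget.IsCert p N s.F) (hμ : 1 ≤ RidgeBudget.jetColength p N s.F) (M : ℕ) :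
    (X j : MvPolynomial (Fin 4) K) ^ (RidgeBudget.jetColength p N s.F - 1) ∈
      singLocusIdeal p (CentreBlowup.step p Finset.univ j b s).F ⊔ originIdeal K ^ M :=
  forall_X_pow_pred_mem_of_forall_X_pow_mem p s j b hbj hord hμ
    (fun M' => RidgeBudget.X_pow_jetColength_mem hc j M') M

/-- **(Λ2′) via any transversal coordinate**: same conclusion starting from `x_i^{μ⁺}` for a coordinate `x_i`
with `j = i ∨ b_i ≠ 0` (the direction of the move is not tangent to `{x_i = 0}`); stated for use with a sharper
exponent when `x_i^ℓ ∈ Ĵ⁺(F)` is known for some `ℓ ≤ μ⁺`. [cite: Kollar2007, Theorem 3.76 (char p, m = p)] -/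
theorem forall_X_pow_pred_mem_of_free_of_le (p : ℕ) [Fact p.Prime] [CharP K p] [DecidableEq K]
    (s : State K) (j i : Fin 4) (b : Fin 4 → K) (hbj : b j = 0) (hfree : j = i ∨ b i ≠ 0)
    (hord : (p : ℕ∞) ≤ CentreBlowup.ordAlong Finset.univ s.F) {ℓ : ℕ} (hℓ : 1 ≤ ℓ)
    (hx : ∀ M : ℕ, (X i : MvPolynomial (Fin 4) K) ^ ℓ ∈ singLocusIdeal p s.F ⊔ originIdeal K ^ M)
    {m : ℕ} (hm : ℓ - 1 ≤ m) (M : ℕ) :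
    (X j : MvPolynomial (Fin 4) K) ^ m ∈
      singLocusIdeal p (CentreBlowup.step p Finset.univ j b s).F ⊔ originIdeal K ^ M := by
  obtain ⟨d, rfl⟩ := Nat.exists_eq_add_of_le hm
  rw [pow_add]
  exact Ideal.mul_mem_right _ _ (forall_X_pow_pred_mem_of_free p s j i b hbj hfree hord hℓ hx M)

end ExceptionalLength

end Summit.ResolutionOfSingularities.ResolutionOfSingularities.Theorems.PIDim4
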